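import Mathlib
import HarnessLib
import Summits.ValiantsHypothesis.ValiantsHypothesis.Theorems.MonotoneRestorationOrbitRestorationQPSmlAffinePermanentQP
import Summits.ValiantsHypothesis.ValiantsHypothesis.Theorems.MonotoneRestorationOrbitRestorationQPSmlAffineResidue

/-!
# The affine set-multilinear stratum at QUASI-POLYNOMIAL budget
(crux `OrbitRestorationQP`, stmt-ValiantsHypothesis-18293 — lane SML of stub A_∞ `stub_sigmaPiSigmaValue`)

`SmlAffineRestoration.affineColSml_restoration` assumes at most `n^c + c` product gates and uses `w = c + 1` slots.  Since the
conclusion is quasi-polynomial anyway, the natural budget is quasi-polynomial: with `w = (log₂ n + c)^c` slots (a function of the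
LEVEL) the same chain gives

* `affineColSml_restoration_vqp` — **a matrix-symmetric family with affine column-set-multilinear `ΣΠΣ` expressions of at most
  `2^((log₂ n + c)^c)` product gates is quasi-polynomially orbit-restorable**;
* `affineRowSml_restoration_vqp` — the row twin (transpose, `+3`).

Numerics: for `8 (log₂ n + c)^c < n` (`SmlAffinePermanent.eight_mul_polylog_lt`) and `J = (log₂ n + c)^c + 1` one has `2J ≤ n`,
`3J ≤ n` and `2^((log₂ n + c)^c) < 2^J ≤ C(2J,J) ≤ C(n-J,J)`, so `exists_equivariant_form_affine` applies with `w = J - 1`; the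
normal form has `≤ (n+1)^{2J}` terms and `eqvTerms_symmetric_size` + `zeta_poly_mul_qp_le 25 2 (c+1) 16` bound the circuit
(`(n+1)^{8J} ≤ 2^{16 (log₂ n + c + 1)^{c+1}}`); small levels by brute force.  So in the VQP regime the landed exponential
lower bound for `per` (`…SmlAffinePermanentQP.lean`) and this upper bound meet: the class at qp budget is restorable and
excludes the permanent.  Honest label: a stratum of the off-path sub-rung A_∞; no stub closed; VP ≠ VNP untouched. [folklore]
-/

noncomputable section

open scoped Classical

-- `Summit.ValiantsHypothesis.ValiantsHypothesis.…` is the tree's single-conjunct layout (Sub = Summit).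
set_option linter.dupNamespace false

namespace Summit.ValiantsHypothesis.ValiantsHypothesis.Theorems.SmlAffineRestoration

open MvPolynomial Finset Equiv Literature.Computability.AlgebraicComplexity OrbitRestorationQPDepthThreeRung SmlRestoration
  SmlAffinePermanent

/-- The exponent arithmetic: `(n+1)^{8((L+c)^c+1)} ≤ 2^{16 (L+c+1)^{c+1}}`, `L = log₂ n`. [folklore] -/
theorem succ_pow_eight_J_le (n c : ℕ) :
    (n + 1) ^ (8 * ((Nat.log 2 n + c) ^ c + 1)) ≤ 2 ^ (16 * (Nat.log 2 n + (c + 1)) ^ (c + 1)) := by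
  set L := Nat.log 2 n with hL
  have hn : n + 1 ≤ 2 ^ (L + 1) := Nat.lt_pow_succ_log_self Nat.one_lt_two n
  have h1 : (n + 1) ^ (8 * ((L + c) ^ c + 1)) ≤ (2 ^ (L + 1)) ^ (8 * ((L + c) ^ c + 1)) := Nat.pow_le_pow_left hn _
  rw [← pow_mul] at h1
  refine h1.trans (Nat.pow_le_pow_right (by norm_num) ?_)
  -- `(L+1) · 8 ((L+c)^c + 1) ≤ 16 (L+c+1)^{c+1}`
  have hA : (L + c) ^ c ≤ (L + (c + 1)) ^ c := Nat.pow_le_pow_left (by omega) c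
  have hB : 1 ≤ (L + (c + 1)) ^ c := Nat.one_le_pow _ _ (by omega)
  have hC : (L + 1) * (L + (c + 1)) ^ c ≤ (L + (c + 1)) ^ (c + 1) := by
    rw [pow_succ]
    calc (L + 1) * (L + (c + 1)) ^ c ≤ (L + (c + 1)) * (L + (c + 1)) ^ c := Nat.mul_le_mul_right _ (by omega)
      _ = (L + (c + 1)) ^ c * (L + (c + 1)) := by ring
  calc (L + 1) * (8 * ((L + c) ^ c + 1)) = 8 * ((L + 1) * (L + c) ^ c + (L + 1)) := by ring
    _ ≤ 8 * ((L + 1) * (L + (c + 1)) ^ c + (L + 1) * (L + (c + 1)) ^ c) := by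
        have h2 : (L + 1) * (L + c) ^ c ≤ (L + 1) * (L + (c + 1)) ^ c := Nat.mul_le_mul_left _ hA
        have h3 : L + 1 ≤ (L + 1) * (L + (c + 1)) ^ c := Nat.le_mul_of_pos_right _ (by omega)
        omega
    _ ≤ 8 * ((L + (c + 1)) ^ (c + 1) + (L + (c + 1)) ^ (c + 1)) := by gcongr
    _ = 16 * (L + (c + 1)) ^ (c + 1) := by ring

/-- **THE AFFINE COLUMN-SML STRATUM AT QUASI-POLYNOMIAL BUDGET.** [folklore] -/
theorem affineColSml_restoration_vqp :
    ∀ f : (n : ℕ) → MvPolynomial (Fin n × Fin n) ℂ, IsMatrixSymmetric f →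
      (∃ c : ℕ, ∀ n : ℕ, ∃ (s : ℕ) (β : Fin s → Fin n → ℂ) (α : Fin s → Fin n → Fin n → ℂ),
        s ≤ 2 ^ ((Nat.log 2 n + c) ^ c) ∧
        f n = ∑ t : Fin s, ∏ b : Fin n, (C (β t b) + ∑ a : Fin n, C (α t b a) * X (a, b))) →
      ∃ c' : ℕ, ∀ n : ℕ, QPOrbitRestorable c' n (f n) := by
  intro f hsym ⟨c, hcirc⟩
  obtain ⟨N₀, hN₀⟩ := eight_mul_polylog_lt c
  obtain ⟨c₃, hc₃⟩ := zeta_poly_mul_qp_le 25 2 (c + 1) 16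
  refine ⟨max c₃ (N₀.factorial + 5), fun n => ?_⟩
  by_cases hn : N₀ ≤ n
  · -- large level: `w = (log₂ n + c)^c` slots
    have h8 := hN₀ n hn
    set x := (Nat.log 2 n + c) ^ c with hx
    have hx1 : 1 ≤ x := by
      rcases Nat.eq_zero_or_pos c with rfl | hc
      · simp [hx]
      · exact Nat.one_le_pow _ _ (by omega)
    have hnpos : 0 < n := by omega
    haveI : NeZero n := ⟨by omega⟩
    obtain ⟨s, β, α, hs, hf⟩ := hcirc n
    have hrow : ∀ σ : Equiv.Perm (Fin n), rename (fun v : Fin n × Fin n => (σ v.1, v.2))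
        (∑ t : Fin s, ∏ b : Fin n, (C (β t b) + ∑ a : Fin n, C (α t b a) * X (a, b)) :
          MvPolynomial (Fin n × Fin n) ℂ) =
        ∑ t : Fin s, ∏ b : Fin n, (C (β t b) + ∑ a : Fin n, C (α t b a) * X (a, b)) := by
      intro σ; rw [← hf]; simpa using hsym n σ 1
    have hcol : ∀ τ : Equiv.Perm (Fin n), rename (fun v : Fin n × Fin n => (v.1, τ v.2))
        (∑ t : Fin s, ∏ b : Fin n, (C (β t b) + ∑ a : Fin n, C (α t b a) * X (a, b)) :
          MvPolynomial (Fin n × Fin n) ℂ) =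
        ∑ t : Fin s, ∏ b : Fin n, (C (β t b) + ∑ a : Fin n, C (α t b a) * X (a, b)) := by
      intro τ; rw [← hf]; simpa using hsym n 1 τ
    -- `s < C(n - (x+1), x+1)`
    have hlt : s < Nat.choose (n - (x + 1)) (x + 1) := by
      have h1 : s < 2 ^ (x + 1) := lt_of_le_of_lt hs (Nat.pow_lt_pow_right (by norm_num) (by omega))
      have h2 : 2 ^ (x + 1) ≤ Nat.choose (2 * (x + 1)) (x + 1) := by
        rw [← Nat.centralBinom_eq_two_mul_choose]
        exact BarrierLever.NaturalProofsSeparateVNP.CRT.two_pow_le_centralBinom _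
      have h3 : Nat.choose (2 * (x + 1)) (x + 1) ≤ Nat.choose (n - (x + 1)) (x + 1) := Nat.choose_le_choose _ (by omega)
      omega
    obtain ⟨d, hd⟩ := exists_equivariant_form_affine (w := x) (by omega) β α hrow hcol hlt
    -- the term multiset and its data
    obtain ⟨h1, -, -, h4⟩ := isEquivariantTerms_affineNormalForm (n := n) (w := x) d
    set T := (Finset.univ : Finset ((Fin (n + 1) × (Fin x → Fin (n + 1))) × (Fin x → Fin n))).val.map fun βτg =>
        C (d βτg.1) ::ₘ (Finset.univ : Finset (Fin n)).val.map fun b =>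
          C ((βτg.1.1 : ℕ) : ℂ) +
            ∑ a : Fin n, C (1 + ∑ i : Fin x, if βτg.2 i = a then ((βτg.1.2 i : ℕ) : ℂ) else 0) * X (a, b) with hT
    set S := (n + 1) ^ (2 * (x + 1)) with hS
    have hcardT : Multiset.card T ≤ S := by
      rw [hT, Multiset.card_map, Finset.card_val, Finset.card_univ, Fintype.card_prod, Fintype.card_prod, Fintype.card_fun,
        Fintype.card_fun, Fintype.card_fin, Fintype.card_fin, Fintype.card_fin, hS]
      calc (n + 1) * (n + 1) ^ x * n ^ x ≤ (n + 1) * (n + 1) ^ x * (n + 1) ^ x :=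
            Nat.mul_le_mul_left _ (Nat.pow_le_pow_left (by omega) _)
        _ = (n + 1) ^ (2 * x + 1) := by rw [← pow_succ', ← pow_add]; ring_nf
        _ ≤ (n + 1) ^ (2 * (x + 1)) := Nat.pow_le_pow_right (by omega) (by omega)
    have hcardm : ∀ m ∈ T, Multiset.card m ≤ S := by
      intro m hm
      rw [hT] at hm
      obtain ⟨βτg, _, rfl⟩ := Multiset.mem_map.1 hm
      rw [Multiset.card_cons, Multiset.card_map, Finset.card_val, Finset.card_univ, Fintype.card_fin, hS]
      calc n + 1 = (n + 1) ^ 1 := (pow_one _).symm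
        _ ≤ (n + 1) ^ (2 * (x + 1)) := Nat.pow_le_pow_right (by omega) (by omega)
    have hT0 : T ≠ 0 := by
      intro h0
      have hc : Multiset.card T = 0 := by rw [h0]; rfl
      rw [hT, Multiset.card_map, Finset.card_val, Finset.card_univ] at hc
      exact Fintype.card_ne_zero hc
    obtain ⟨G, inst, Cc, hC, hev, hsize⟩ := eqvTerms_symmetric_size S T hT0 h1 hcardT hcardm h4
    have hval : (T.map Multiset.prod).sum = f n := by rw [hT, sum_prod_affineNormalForm, ← hd, ← hf]
    refine Restorable.qpOrbitRestorable_mono (le_max_left _ _) ⟨G, inst, Cc, hC, by rw [hev, hval], ?_⟩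
    refine (Cc.orbitSize_le_size _).trans (hsize.trans ?_)
    refine (eqvTerms_size_arith n S (Nat.one_le_pow _ _ (by omega))).trans ?_
    -- `25 (n+2)² S⁴ ≤ 2^((log₂ n + c₃)^c₃)`
    have hS4 : S ^ 4 ≤ 2 ^ (16 * (Nat.log 2 n + (c + 1)) ^ (c + 1)) := by
      rw [hS, ← pow_mul, show 2 * (x + 1) * 4 = 8 * (x + 1) by ring, hx]
      exact succ_pow_eight_J_le n c
    exact (Nat.mul_le_mul_left _ hS4).trans (hc₃ n)
  · have hinv : ∀ σ : Equiv.Perm (Fin n), ren σ (f n) = f n := fun σ => ValueOrbit.ren_eq_of_matrixSymmetric (hsym n) σ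
    refine Restorable.qpOrbitRestorable_mono ?_ (Restorable.qpOrbitRestorable_of_invariant (f n) hinv)
    have : n.factorial ≤ N₀.factorial := Nat.factorial_le (by omega)
    omega

/-- **THE AFFINE ROW-SML STRATUM AT QUASI-POLYNOMIAL BUDGET** (transpose twin, `+3`). [folklore] -/
theorem affineRowSml_restoration_vqp :
    ∀ f : (n : ℕ) → MvPolynomial (Fin n × Fin n) ℂ, IsMatrixSymmetric f →
      (∃ c : ℕ, ∀ n : ℕ, ∃ (s : ℕ) (β : Fin s → Fin n → ℂ) (α : Fin s → Fin n → Fin n → ℂ),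
        s ≤ 2 ^ ((Nat.log 2 n + c) ^ c) ∧
        f n = ∑ t : Fin s, ∏ a : Fin n, (C (β t a) + ∑ b : Fin n, C (α t a b) * X (a, b))) →
      ∃ c' : ℕ, ∀ n : ℕ, QPOrbitRestorable c' n (f n) := by
  intro f hsym ⟨c, hcirc⟩
  have hT : ∃ c₁ : ℕ, ∀ n : ℕ, ∃ (s : ℕ) (β : Fin s → Fin n → ℂ) (α : Fin s → Fin n → Fin n → ℂ),
      s ≤ 2 ^ ((Nat.log 2 n + c₁) ^ c₁) ∧
      rename (Prod.swap : Fin n × Fin n → Fin n × Fin n) (f n) =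
        ∑ t : Fin s, ∏ b : Fin n, (C (β t b) + ∑ a : Fin n, C (α t b a) * X (a, b)) := by
    refine ⟨c, fun n => ?_⟩
    obtain ⟨s, β, α, hs, hf⟩ := hcirc n
    exact ⟨s, β, α, hs, by rw [hf, rename_swap_affineRowSml]⟩
  obtain ⟨c', hc'⟩ := affineColSml_restoration_vqp _ (isMatrixSymmetric_transpose hsym) hT
  exact ⟨c' + 3, fun n => Transpose.qpOrbitRestorable_of_transpose (hc' n)⟩

end Summit.ValiantsHypothesis.ValiantsHypothesis.Theorems.SmlAffineRestoration

end
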